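import Summits.SmoothPoincare4.SmoothPoincare4.Theorems.DottedCircleRasmussenDcrGapHelperHandlebodyChartModelHandlesRadialFlow
import Summits.SmoothPoincare4.SmoothPoincare4.Theorems.DottedCircleRasmussenDcrGapHelperHandlebodyChartModelHandlesRadialEnd
import Summits.SmoothPoincare4.SmoothPoincare4.Theorems.DottedCircleRasmussenDcrGapHelperHandlebodyChartModelHandlesInflate
import Summits.SmoothPoincare4.SmoothPoincare4.Theorems.DottedCircleRasmussenDcrGapHelperHandlebodyChartModelHandlesFibreSqueeze
import Summits.SmoothPoincare4.SmoothPoincare4.Theorems.DottedCircleRasmussenDcrGapHelperHandlebodyChartModelHandlesSqueezeComp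

/-!
# Helper `helper_handlebodyChart_modelHandles` (M3: handle structure of the model dotted handlebody `D_k`)
# of line `mk_friends` for crux `DcrGap` — part 2 of the data stub: the equivariant squeeze
(item stmt-SmoothPoincare4-16128, route route-SmoothPoincare4-DottedCircleRasmussen)

**Registered stub `helper_handlebodyChart_modelHandles_data_part2` (part 2 of the split of the data stub
`helper_handlebodyChart_modelHandles_data` of the model lemma M3), and its last stage
`helper_handlebodyChart_modelHandles_radialSqueeze`.**  For every open `U ⊇ D_k` and `2/15 < ρ < 1/5` there is
a diffeomorphism `κ` of `ℝ⁴ = ℂ²`, the identity off a compact subset of `U`, commuting with the rotations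
`(z, w) ↦ (z, u w)` of the `w`-plane, carrying `D_k = MMSW.modelHandlebody k` into the ball `B̄(c, ρ)`
(`c = (z₀, 0)`, `z₀ = -20k i`) united with the explicit thin arches `A_j` of the holes (`|w| ≤ 1/(2000(k+1))` and
either the cap `8/5 ≤ |z - c_j| ≤ 41/25` on the far/lateral side `Re((z - c_j) \bar v) ≥ -(7/10)|v|`,
`v = c_j - z₀`, or the two thin wedges of rays from `z₀` passing `c_j` at lateral distance `∈ [8/5, 41/25]`, between
the ball `|z - z₀| ≥ 2/15` and the chord `|z - z₀| ≤ |v| + 1/2`), together with smooth rotation-invariant lifts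
near `D_k` of the angles swept about the hole centres.

* `ModelHandles.exists_radial_squeeze` — the last stage in the form consumed by the composition lemma
  `…ModelHandlesSqueezeComp`: the time-`T` map (`T = 450(k+1)`) of the cut-off radial flow of
  `…ModelHandlesRadialFlow` towards `z₀`, the identity off a compact subset of `D_k`, equivariant, fixing `w`,
  carrying every point of `S = D_k ∩ {G_k ≤ 24/25} ∩ {|w| ≤ δ} ∩ {∀ j, |z - c_j|² ≥ 11/4}` (`δ ≤ 1/10`) into the
  slab `|z - z₀| ≤ 2/15` or into the planar arch of some hole — the orbit structure of `…ModelHandlesRadialFlow`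
  fed into the end-state analysis `…ModelHandlesRadialEnd` (`e^T ≥ 450(k+1)` and `|z(0) - z₀| ≤ 60(k+1)` give
  the radius `2/15`) — with swept-angle lifts from `…ModelHandlesFlowPhase` (the shadows stay at distance
  `≥ 8/5` from every hole centre).
* `ModelHandles.data_part2` — the composite (`…ModelHandlesSqueezeComp`: supports unite, swept angles add) of
  the four equivariant stages: (1) the collar push into `D_k ∩ {G_k ≤ 24/25}` with its swept angles
  (`…ModelHandlesCollarPhase`), the only stage supported outside `D_k`; (2) the radial squeeze of the `w`-fibres
  to `|w| ≤ δ`, `δ = min(1/(2000(k+1)), ρ - 2/15)` (`…ModelHandlesFibreSqueeze`; `z` fixed, swept angles `0`);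
  (3) the inflation of the holes to `|z - c_j|² ≥ 11/4` (`…ModelHandlesInflate`); (4) the radial squeeze above,
  after which a shadow within `2/15` of `z₀` means a point of `B̄(c, ρ)`, as `(2/15)² + δ² ≤ ρ²`.

No definitions, no named facts, no `sorry`.  References: J. Milnor, *Morse Theory* (1963), §3 [Milnor1963];
M. W. Hirsch, *Differential Topology* (1976), Ch. 8 §1 [HirschDT1976].
-/

-- the prescribed namespace `Summit.<P>.<Sub>.…` duplicates `SmoothPoincare4` (P = Sub)
set_option linter.dupNamespace false
set_option linter.style.longLine false

noncomputable section

open scoped Manifold ContDiff Topology ComplexConjugate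
open Function Set Metric Filter
open Literature.Topology.FourManifolds Literature.Topology.FourManifolds.MMSW
open Literature.AlgebraicTopology.Homotopy.HopfFibration

namespace Summit.SmoothPoincare4.SmoothPoincare4.Theorems.DcrGap.MkFriends

namespace ModelHandles

/-- The shadow of a point of `D_k` has norm `≤ R = 40(k+1)`. [folklore] -/
theorem norm_zC_le_of_mem {k : ℕ} {x : EuclideanSpace ℝ (Fin 4)} (hx : x ∈ modelHandlebody k) :
    ‖zC x‖ ≤ 40 * ((k : ℝ) + 1) := by
  have hpos : ∀ j, 0 < holeTerm k j x := fun j => lt_of_lt_of_le one_pos (hx.1 j)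
  have h := (FriendsH2.levelFun_bounds hpos).1
  have hz : ‖zC x‖ ^ 2 = x 0 ^ 2 + x 1 ^ 2 := by
    rw [Complex.sq_norm, Complex.normSq_apply]; simp [zC, sq]
  have hR : (0 : ℝ) < (40 * ((k : ℝ) + 1)) ^ 2 := by positivity
  rw [div_le_iff₀ hR] at h
  have h2 : ‖zC x‖ ^ 2 ≤ (40 * ((k : ℝ) + 1)) ^ 2 := by rw [hz]; nlinarith [hx.2]
  exact le_of_pow_le_pow_left₀ two_ne_zero (by positivity) h2

/-- The hole centres are at distance `≥ 20` from the base centre `z₀ = -20k i`. [folklore] -/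
theorem norm_holeCentre_sub_base_ge {k : ℕ} (j : Fin k) :
    (20 : ℝ) ≤ ‖holeCentre k j - Complex.mk 0 (-(20 * (k : ℝ)))‖ := by
  have hk : (1 : ℝ) ≤ k := by exact_mod_cast Nat.succ_le_of_lt (Fin.pos j)
  have him : (holeCentre k j - Complex.mk 0 (-(20 * (k : ℝ)))).im = 20 * k := by simp
  have h := Complex.abs_im_le_norm (holeCentre k j - Complex.mk 0 (-(20 * (k : ℝ))))
  rw [him, abs_of_nonneg (by positivity)] at h
  linarith

/-- **The cut-off radial squeeze towards the base centre** (stage form of `exists_radial_flow`, with the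
end-state analysis `radial_end` and swept angles; see the module docstring). [folklore] -/
theorem exists_radial_squeeze (k : ℕ) {δ : ℝ} (hδ1 : δ ≤ 1 / 10) :
    ∃ (κ : EuclideanSpace ℝ (Fin 4) ≃ₘ⟮𝓡 4, 𝓡 4⟯ EuclideanSpace ℝ (Fin 4))
      (K N₀ : Set (EuclideanSpace ℝ (Fin 4))) (SW : Fin k → EuclideanSpace ℝ (Fin 4) → ℝ),
      IsCompact K ∧ K ⊆ modelHandlebody k ∧ (∀ x, x ∉ K → κ x = x) ∧
      (∀ u : ℂ, ‖u‖ = 1 → ∀ x, κ (fibreRot (fun _ => u) x) = fibreRot (fun _ => u) (κ x)) ∧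
      (∀ x, wC (κ x) = wC x) ∧
      (∀ x ∈ {x | x ∈ modelHandlebody k ∧ levelFun k x ≤ 24 / 25 ∧ ‖wC x‖ ≤ δ ∧ ∀ j, (11 : ℝ) / 4 ≤ holeTerm k j x},
        ‖zC (κ x) - Complex.mk 0 (-(20 * (k : ℝ)))‖ ≤ 2 / 15 ∨ ∃ j, ∀ (q v : ℂ),
          q = zC (κ x) - Complex.mk 0 (-(20 * (k : ℝ))) → v = holeCentre k j - Complex.mk 0 (-(20 * (k : ℝ))) →
          (8 / 5 ≤ ‖q - v‖ ∧ ‖q - v‖ ≤ 41 / 25 ∧ -(7 / 10) * ‖v‖ ≤ ((q - v) * conj v).re) ∨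
          (2 / 15 ≤ ‖q‖ ∧ ‖q‖ ≤ ‖v‖ + 1 / 2 ∧ 0 < (q * conj v).re ∧ 8 / 5 * ‖q‖ ≤ |(q * conj v).im| ∧
            |(q * conj v).im| ≤ 41 / 25 * ‖q‖)) ∧
      IsOpen N₀ ∧ {x | x ∈ modelHandlebody k ∧ levelFun k x ≤ 24 / 25 ∧ ‖wC x‖ ≤ δ ∧ ∀ j, (11 : ℝ) / 4 ≤ holeTerm k j x} ⊆ N₀ ∧
      (∀ l, ContDiffOn ℝ ∞ (SW l) N₀) ∧
      (∀ l (u : ℂ), ‖u‖ = 1 → ∀ x, SW l (fibreRot (fun _ => u) x) = SW l x) ∧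
      ∀ l, ∀ x ∈ {x | x ∈ modelHandlebody k ∧ levelFun k x ≤ 24 / 25 ∧ ‖wC x‖ ≤ δ ∧ ∀ j, (11 : ℝ) / 4 ≤ holeTerm k j x},
        (zC (κ x) - holeCentre k l) / ((‖zC (κ x) - holeCentre k l‖ : ℝ) : ℂ) =
          Complex.exp ((SW l x : ℂ) * Complex.I) *
            ((zC x - holeCentre k l) / ((‖zC x - holeCentre k l‖ : ℝ) : ℂ)) := by
  set z₀ : ℂ := Complex.mk 0 (-(20 * (k : ℝ))) with hz₀
  set S : Set (EuclideanSpace ℝ (Fin 4)) := {x | x ∈ modelHandlebody k ∧ levelFun k x ≤ 24 / 25 ∧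
    ‖wC x‖ ≤ δ ∧ ∀ j, (11 : ℝ) / 4 ≤ holeTerm k j x} with hS
  obtain ⟨θ, V, K, hθs, h0, -, hint, hVc, hKc, hKD, hVK, hfixK, hstage, hcomm, hw, horbit⟩ :=
    exists_radial_flow k
  set T : ℝ := 450 * ((k : ℝ) + 1) with hT
  have hT0 : 0 ≤ T := by positivity
  -- velocity bound and swept angles
  obtain ⟨M, hM0, hM⟩ : ∃ M : ℝ, 0 < M ∧ ∀ y, ‖V y‖ ≤ M := by
    obtain ⟨C, hC⟩ := hKc.exists_bound_of_continuousOn hVc.continuousOn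
    refine ⟨max C 0 + 1, by positivity, fun y => ?_⟩
    by_cases hy : y ∈ K
    · exact (hC y hy).trans (by linarith [le_max_left C 0])
    · rw [hVK y hy, norm_zero]; positivity
  have hfar : ∀ x ∈ S, ∀ t : ℝ, 0 ≤ t → t ≤ T → ∀ l : Fin k, (8 : ℝ) / 5 ≤ ‖zC (θ (t, x)) - holeCentre k l‖ := by
    intro x hx t ht _ l
    have h := ((horbit x hx.1 hx.2.1 (hx.2.2.1.trans hδ1) hx.2.2.2).1 t ht).2 l
    rw [holeTerm_eq_normSq, Complex.normSq_eq_norm_sq] at h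
    nlinarith [norm_nonneg (zC (θ (t, x)) - holeCentre k l)]
  obtain ⟨N₀, SW, hN₀o, hSN, hSWs, hSWrot, hsw⟩ :=
    flow_phase k hθs h0 hint hM hM0 hT0 (by norm_num : (0 : ℝ) < 8 / 5) hcomm hfar
  obtain ⟨Φ, hΦ⟩ := hstage T
  refine ⟨Φ, K, N₀, SW, hKc, hKD, fun x hx => ?_, fun u hu x => ?_, fun x => ?_, fun x hx => ?_,
    hN₀o, hSN, hSWs, hSWrot, fun l x hx => ?_⟩
  · rw [hΦ]; exact hfixK x hx _
  · rw [hΦ, hΦ]; exact hcomm u hu _ _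
  · rw [hΦ]; exact hw x T
  swap
  · rw [hΦ]; exact hsw l x hx
  -- the image of a point of `S`
  rw [hΦ]
  obtain ⟨hmem, Λ, hΛc, hΛ0, hΛ01, hΛanti, hΛq, hΛexp⟩ :=
    horbit x hx.1 hx.2.1 (hx.2.2.1.trans hδ1) hx.2.2.2
  set q₀ : ℂ := zC x - z₀ with hq₀
  by_cases hq0 : q₀ = 0
  · left
    rw [hΛq T hT0, hq0, mul_zero, norm_zero]; norm_num
  -- the unit vector of the ray and the reduced centres
  set N : ℝ := ‖q₀‖ with hN
  have hN0 : 0 < N := norm_pos_iff.2 hq0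
  have hNc : (N : ℂ) ≠ 0 := by exact_mod_cast hN0.ne'
  set u : ℂ := q₀ / (N : ℂ) with hu
  have hq₀u : q₀ = (N : ℂ) * u := by rw [hu]; field_simp
  have hun : ‖u‖ = 1 := by
    rw [hu, norm_div, Complex.norm_real, Real.norm_of_nonneg hN0.le]; exact div_self hN0.ne'
  have huu : u * conj u = 1 := by
    rw [Complex.mul_conj, Complex.normSq_eq_norm_sq, hun]; simp
  set w : Fin k → ℂ := fun j => (holeCentre k j - z₀) * conj u with hwdef
  have hvw : ∀ j, holeCentre k j - z₀ = w j * u := fun j => by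
    rw [hwdef, mul_assoc, mul_comm (conj u), huu, mul_one]
  have hwn : ∀ j, ‖w j‖ = ‖holeCentre k j - z₀‖ := fun j => by
    rw [hwdef, norm_mul, Complex.norm_conj, hun, mul_one]
  set s : ℝ → ℝ := fun t => Λ t * N with hs
  -- the hole terms along the orbit are the parabolas of `radial_end`
  have hshadow : ∀ t, 0 ≤ t → ∀ j, zC (θ (t, x)) - holeCentre k j = ((s t : ℂ) - w j) * u := by
    intro t ht j
    have h1 : zC (θ (t, x)) - holeCentre k j = (zC (θ (t, x)) - z₀) - (holeCentre k j - z₀) := by ring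
    rw [h1, hΛq t ht, hq₀u, hvw j]
    simp only [hs]
    push_cast
    ring
  have hD : ∀ t, 0 ≤ t → ∀ j, holeTerm k j (θ (t, x)) = (s t - (w j).re) ^ 2 + (w j).im ^ 2 := by
    intro t ht j
    rw [holeTerm_eq_normSq, hshadow t ht j, map_mul, Complex.normSq_eq_norm_sq u, hun, one_pow, mul_one,
      Complex.normSq_apply]
    simp only [Complex.sub_re, Complex.sub_im, Complex.ofReal_re, Complex.ofReal_im]
    ring
  -- the end-state analysis
  have hend := radial_end (s := s) (w := w) (N := N) (T := T) hT0
    (by simp only [hs, hΛ0, one_mul])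
    ((hΛc.mul continuous_const).continuousOn)
    (fun a ha b hb hab => mul_le_mul_of_nonneg_right (hΛanti (mem_Ici.2 ha.1) (mem_Ici.2 hb.1) hab) hN0.le)
    (fun t ht => mul_pos (hΛ01 t ht.1).1 hN0)
    (fun j => by rw [← hD 0 le_rfl j, h0]; exact hx.2.2.2 j)
    (fun t ht j => by rw [← hD t ht.1 j]; exact (hmem t ht.1).2 j)
    (fun hall => by
      have hΛT : Λ T = Real.exp (-T) := by
        have h := hΛexp 0 T le_rfl hT0 fun t ht j => by rw [hD t ht.1 j]; exact hall t ht j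
        rw [hΛ0, one_mul, sub_zero] at h
        exact h
      have hN60 : N ≤ 60 * ((k : ℝ) + 1) := by
        have h1 : ‖q₀‖ ≤ ‖zC x‖ + ‖z₀‖ := norm_sub_le _ _
        have h2 := norm_zC_le_of_mem hx.1
        have h3 : ‖z₀‖ = 20 * k := by
          simp only [hz₀, Complex.norm_eq_sqrt_sq_add_sq]
          rw [show (0 : ℝ) ^ 2 + (-(20 * (k : ℝ))) ^ 2 = (20 * k) ^ 2 by ring,
            Real.sqrt_sq (by positivity)]
        have hk : (0 : ℝ) ≤ k := k.cast_nonneg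
        rw [hN]; linarith
      have hexp : T + 1 ≤ Real.exp T := Real.add_one_le_exp T
      have hpos : 0 < Real.exp (-T) := Real.exp_pos _
      have hprod : Real.exp (-T) * Real.exp T = 1 := by rw [← Real.exp_add]; simp
      simp only [hs, hΛT]
      -- `e^{-T} N ≤ 60(k+1)/(450(k+1) + 1) ≤ 2/15`
      have h2 : (60 : ℝ) * ((k : ℝ) + 1) ≤ 2 / 15 * (T + 1) := by simp only [hT]; nlinarith
      have h1 : Real.exp (-T) * N * Real.exp T ≤ 2 / 15 * Real.exp T := by
        rw [mul_assoc, mul_comm N, ← mul_assoc, hprod, one_mul]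
        linarith
      exact le_of_mul_le_mul_right h1 (Real.exp_pos T))
    (fun j => by rw [hwn]; exact norm_holeCentre_sub_base_ge j)
  -- translate back to the shadow
  have hqT : zC (θ (T, x)) - z₀ = (s T : ℂ) * u := by
    rw [hΛq T hT0, hq₀u]; simp only [hs]; push_cast; ring
  have hsT : 0 < s T := mul_pos (hΛ01 T hT0).1 hN0
  have hnq : ‖zC (θ (T, x)) - z₀‖ = s T := by
    rw [hqT, norm_mul, hun, mul_one, Complex.norm_real, Real.norm_of_nonneg hsT.le]
  rcases hend with hball | ⟨j, hj⟩
  · left; rw [hnq]; exact hball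
  right
  refine ⟨j, fun q v hq hv => ?_⟩
  have hwnorm : ‖w j‖ ^ 2 = (w j).re ^ 2 + (w j).im ^ 2 := by
    rw [Complex.sq_norm, Complex.normSq_apply]; ring
  have hqv : q - v = ((s T : ℂ) - w j) * u := by rw [hq, hv, hqT, hvw j]; ring
  have hnqv : ‖q - v‖ ^ 2 = (s T - (w j).re) ^ 2 + (w j).im ^ 2 := by
    rw [hqv, norm_mul, hun, mul_one, Complex.sq_norm, Complex.normSq_apply]
    simp only [Complex.sub_re, Complex.sub_im, Complex.ofReal_re, Complex.ofReal_im]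
    ring
  have hre1 : ((q - v) * conj v).re = s T * (w j).re - ‖w j‖ ^ 2 := by
    rw [hqv, hv, hvw j, map_mul, show ((s T : ℂ) - w j) * u * (conj (w j) * conj u) =
      ((s T : ℂ) - w j) * conj (w j) * (u * conj u) by ring, huu, mul_one, hwnorm]
    simp only [Complex.mul_re, Complex.sub_re, Complex.sub_im, Complex.ofReal_re, Complex.ofReal_im,
      Complex.conj_re, Complex.conj_im]
    ring
  have hqc : q * conj v = (s T : ℂ) * conj (w j) := by
    rw [hq, hqT, hv, hvw j, map_mul, show (s T : ℂ) * u * (conj (w j) * conj u) =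
      (s T : ℂ) * conj (w j) * (u * conj u) by ring, huu, mul_one]
  have hre2 : (q * conj v).re = s T * (w j).re := by rw [hqc]; simp
  have him2 : |(q * conj v).im| = |s T * (w j).im| := by
    rw [hqc]; simp [abs_mul]
  have hnq' : ‖q‖ = s T := by rw [hq, hnq]
  have hnv : ‖v‖ = ‖w j‖ := by rw [hv, ← hwn]
  rw [hre1, hre2, him2, hnq', hnv]
  rcases hj with ⟨h1, h2, h3⟩ | ⟨h1, h2, h3, h4, h5⟩
  · refine Or.inl ⟨?_, ?_, h3⟩
    · exact le_of_pow_le_pow_left₀ two_ne_zero (norm_nonneg _) (by rw [hnqv]; nlinarith)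
    · exact le_of_pow_le_pow_left₀ two_ne_zero (by norm_num) (by rw [hnqv]; nlinarith)
  · exact Or.inr ⟨h1, h2, h3, h4, h5⟩


/-- **The equivariant squeeze of the model handlebody into ball and arches** (see the module docstring):
the composite of the collar push, the fibre squeeze, the inflation of the holes and the cut-off radial flow.
[folklore] -/
theorem data_part2 (k : ℕ) (U : Set (EuclideanSpace ℝ (Fin 4))) (ρ : ℝ) (hUo : IsOpen U)
    (hDU : modelHandlebody k ⊆ U) (hρ1 : 2 / 15 < ρ) (hρ2 : ρ < 1 / 5) :
    ∃ (κ : EuclideanSpace ℝ (Fin 4) ≃ₘ⟮𝓡 4, 𝓡 4⟯ EuclideanSpace ℝ (Fin 4)) (K N₀ : Set (EuclideanSpace ℝ (Fin 4)))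
      (SW : Fin k → EuclideanSpace ℝ (Fin 4) → ℝ), IsCompact K ∧ K ⊆ U ∧ (∀ x, x ∉ K → κ x = x) ∧
      (∀ v : ℂ, ‖v‖ = 1 → ∀ x, κ (fibreRot (fun _ => v) x) = fibreRot (fun _ => v) (κ x)) ∧
      (∀ x ∈ modelHandlebody k, κ x ∈ closedBall (ofZW (Complex.mk 0 (-(20 * (k : ℝ)))) 0) ρ ∨
        ∃ j, ∀ (q v : ℂ), q = zC (κ x) - Complex.mk 0 (-(20 * (k : ℝ))) →
          v = holeCentre k j - Complex.mk 0 (-(20 * (k : ℝ))) →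
          ‖wC (κ x)‖ ≤ 1 / (2000 * ((k : ℝ) + 1)) ∧
          ((8 / 5 ≤ ‖q - v‖ ∧ ‖q - v‖ ≤ 41 / 25 ∧ -(7 / 10) * ‖v‖ ≤ ((q - v) * conj v).re) ∨
          (2 / 15 ≤ ‖q‖ ∧ ‖q‖ ≤ ‖v‖ + 1 / 2 ∧ 0 < (q * conj v).re ∧ 8 / 5 * ‖q‖ ≤ |(q * conj v).im| ∧
            |(q * conj v).im| ≤ 41 / 25 * ‖q‖))) ∧
      IsOpen N₀ ∧ modelHandlebody k ⊆ N₀ ∧ (∀ l, ContDiffOn ℝ ∞ (SW l) N₀) ∧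
      (∀ l (v : ℂ), ‖v‖ = 1 → ∀ x, SW l (fibreRot (fun _ => v) x) = SW l x) ∧
      ∀ l, ∀ x ∈ modelHandlebody k,
        (zC (κ x) - holeCentre k l) / ((‖zC (κ x) - holeCentre k l‖ : ℝ) : ℂ) =
          Complex.exp ((SW l x : ℂ) * Complex.I) *
            ((zC x - holeCentre k l) / ((‖zC x - holeCentre k l‖ : ℝ) : ℂ)) := by
  set z₀ : ℂ := Complex.mk 0 (-(20 * (k : ℝ))) with hz₀
  -- the fibre radius
  set δ : ℝ := min (1 / (2000 * ((k : ℝ) + 1))) (ρ - 2 / 15) with hδ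
  have hδ0 : 0 < δ := lt_min (by positivity) (by linarith)
  have hδw : δ ≤ 1 / (2000 * ((k : ℝ) + 1)) := min_le_left _ _
  have hδρ : δ ≤ ρ - 2 / 15 := min_le_right _ _
  have hδ1 : δ ≤ 1 / 10 := hδw.trans (by
    rw [div_le_div_iff₀ (by positivity) (by norm_num)]
    nlinarith [(k.cast_nonneg : (0 : ℝ) ≤ k)])
  -- the sets between the stages
  set S₁ : Set (EuclideanSpace ℝ (Fin 4)) := {x | x ∈ modelHandlebody k ∧ levelFun k x ≤ 24 / 25} with hS₁
  set S₃ : Set (EuclideanSpace ℝ (Fin 4)) := {x | x ∈ modelHandlebody k ∧ levelFun k x ≤ 24 / 25 ∧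
    ‖wC x‖ ≤ δ ∧ ∀ j, (11 : ℝ) / 4 ≤ holeTerm k j x} with hS₃
  -- stage 1: the collar push
  obtain ⟨κ₁, K₁, N₁, SW₁, h1c, h1U, h1id, h1img, h1rot, h1o, h1S, h1s, h1inv, h1sw⟩ :=
    exists_collar_phase k hUo hDU
  -- stage 2: the fibre squeeze (fixes `z`: swept angles `0`)
  obtain ⟨κ₂, K₂, h2c, h2D, h2id, h2rot, h2z, -, h2T, h2G, h2img⟩ := exists_fibre_squeeze k hδ0
  have h2sw : ∀ l, ∀ x ∈ S₁, (zC (κ₂ x) - holeCentre k l) / ((‖zC (κ₂ x) - holeCentre k l‖ : ℝ) : ℂ) =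
      Complex.exp ((((fun _ _ => (0 : ℝ)) : Fin k → EuclideanSpace ℝ (Fin 4) → ℝ) l x : ℂ) * Complex.I) *
        ((zC x - holeCentre k l) / ((‖zC x - holeCentre k l‖ : ℝ) : ℂ)) := by
    intro l x _
    simp [h2z]
  obtain ⟨κ₁₂, K₁₂, N₁₂, SW₁₂, h12c, h12U, h12id, h12rot, h12eq, h12o, h12S, h12s, h12inv, h12sw⟩ :=
    squeeze_comp (U := U) (S := modelHandlebody k) (S₂ := S₁) (N₂ := univ) (SW₂ := fun _ _ => (0 : ℝ)) κ₁ κ₂ h1c h1U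
      h1id h1rot h1o h1S h1s h1inv h1sw h2c (h2D.trans hDU) h2id h2rot isOpen_univ (subset_univ _)
      (fun _ => contDiffOn_const) (fun _ _ _ _ => rfl) h2sw (fun x hx => h1img x hx)
  have h12img : MapsTo κ₁₂ (modelHandlebody k) S₁ ∧ ∀ x ∈ modelHandlebody k, ‖wC (κ₁₂ x)‖ ≤ δ := by
    refine ⟨fun x hx => ?_, fun x hx => ?_⟩
    · rw [h12eq]
      obtain ⟨hm, hG⟩ := h1img x hx
      exact ⟨⟨fun j => by rw [h2T]; exact hm.1 j, (h2G _).trans hm.2⟩, (h2G _).trans hG⟩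
    · rw [h12eq]
      obtain ⟨hm, hG⟩ := h1img x hx
      exact h2img _ hm hG
  -- stage 3: the inflation of the holes
  obtain ⟨κ₃, K₃, N₃, SW₃, h3c, h3D, h3id, h3rot, h3w, h3img, h3o, h3S, h3s, h3inv, h3sw⟩ := exists_inflate k
  obtain ⟨κ₁₂₃, K₁₂₃, N₁₂₃, SW₁₂₃, h123c, h123U, h123id, h123rot, h123eq, h123o, h123S, h123s, h123inv, h123sw⟩ :=
    squeeze_comp (U := U) (S := modelHandlebody k) (S₂ := S₁) κ₁₂ κ₃ h12c h12U h12id h12rot h12o h12S h12s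
      h12inv h12sw h3c (h3D.trans hDU) h3id h3rot h3o h3S h3s h3inv h3sw h12img.1
  have h123img : MapsTo κ₁₂₃ (modelHandlebody k) S₃ := by
    intro x hx
    rw [h123eq]
    obtain ⟨hm, hG⟩ := h12img.1 hx
    obtain ⟨hm', hG', hT'⟩ := h3img _ hm hG
    exact ⟨hm', hG', by rw [h3w]; exact h12img.2 x hx, hT'⟩
  -- stage 4: the cut-off radial flow
  obtain ⟨κ₄, K₄, N₄, SW₄, h4c, h4D, h4id, h4rot, h4w, h4img, h4o, h4S, h4s, h4inv, h4sw⟩ :=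
    exists_radial_squeeze k hδ1
  obtain ⟨κ, K, N₀, SW, hKc, hKU, hid, hrot, heq, hN₀o, hSN, hSWs, hSWinv, hsw⟩ :=
    squeeze_comp (U := U) (S := modelHandlebody k) (S₂ := S₃) κ₁₂₃ κ₄ h123c h123U h123id h123rot h123o h123S
      h123s h123inv h123sw h4c (h4D.trans hDU) h4id h4rot h4o h4S h4s h4inv h4sw h123img
  refine ⟨κ, K, N₀, SW, hKc, hKU, hid, hrot, fun x hx => ?_, hN₀o, hSN, hSWs, hSWinv, hsw⟩
  -- the image of `D_k`
  have hy : κ₁₂₃ x ∈ S₃ := h123img hx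
  have hwκ : ‖wC (κ x)‖ ≤ δ := by rw [heq, h4w]; exact hy.2.2.1
  rcases h4img _ hy with hball | ⟨j, hj⟩
  · left
    rw [mem_closedBall, dist_eq_norm]
    have hsq := normSq_zC_sub_add (κ x) (ofZW z₀ 0)
    rw [zC_ofZW, wC_ofZW, sub_zero] at hsq
    have h1 : Complex.normSq (zC (κ x) - z₀) ≤ (2 / 15) ^ 2 := by
      rw [Complex.normSq_eq_norm_sq, heq]; exact pow_le_pow_left₀ (norm_nonneg _) hball 2
    have h2 : Complex.normSq (wC (κ x)) ≤ (ρ - 2 / 15) ^ 2 := by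
      rw [Complex.normSq_eq_norm_sq]; exact pow_le_pow_left₀ (norm_nonneg _) (hwκ.trans hδρ) 2
    have h3 : ‖κ x - ofZW z₀ 0‖ ^ 2 ≤ ρ ^ 2 := by nlinarith
    exact le_of_pow_le_pow_left₀ two_ne_zero (by linarith) h3
  · right
    refine ⟨j, fun q v hq hv => ⟨hwκ.trans hδw, ?_⟩⟩
    rw [heq] at hq
    exact hj q v hq hv

end ModelHandles

/-- **Registered piece `helper_handlebodyChart_modelHandles_radialSqueeze` of the model lemma M3 (the
cut-off radial squeeze towards the base centre, stage form with end states and swept angles)**: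
`ModelHandles.exists_radial_squeeze`, fully quantified. [folklore] -/
theorem helper_handlebodyChart_modelHandles_radialSqueeze : ∀ (k : ℕ) (δ : ℝ), δ ≤ 1 / 10 → ∃ (κ : EuclideanSpace ℝ (Fin 4) ≃ₘ⟮𝓡 4, 𝓡 4⟯ EuclideanSpace ℝ (Fin 4)) (K N₀ : Set (EuclideanSpace ℝ (Fin 4))) (SW : Fin k → EuclideanSpace ℝ (Fin 4) → ℝ), IsCompact K ∧ K ⊆ Literature.Topology.FourManifolds.MMSW.modelHandlebody k ∧ (∀ x, x ∉ K → κ x = x) ∧ (∀ u : ℂ, ‖u‖ = 1 → ∀ x, κ (Literature.Topology.FourManifolds.MMSW.fibreRot (fun _ => u) x) = Literature.Topology.FourManifolds.MMSW.fibreRot (fun _ => u) (κ x)) ∧ (∀ x, Literature.AlgebraicTopology.Homotopy.HopfFibration.wC (κ x) = Literature.AlgebraicTopology.Homotopy.HopfFibration.wC x) ∧ (∀ x ∈ {x : EuclideanSpace ℝ (Fin 4) | x ∈ Literature.Topology.FourManifolds.MMSW.modelHandlebody k ∧ Literature.Topology.FourManifolds.MMSW.levelFun k x ≤ 24 / 25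 ∧ ‖Literature.AlgebraicTopology.Homotopy.HopfFibration.wC x‖ ≤ δ ∧ ∀ j, (11 : ℝ) / 4 ≤ Literature.Topology.FourManifolds.MMSW.holeTerm k j x}, ‖Literature.AlgebraicTopology.Homotopy.HopfFibration.zC (κ x) - Complex.mk 0 (-(20 * (k : ℝ)))‖ ≤ 2 / 15 ∨ ∃ j, ∀ (q v : ℂ), q = Literature.AlgebraicTopology.Homotopy.HopfFibration.zC (κ x) - Complex.mk 0 (-(20 * (k : ℝ))) → v = Literature.Topology.FourManifolds.MMSW.holeCentre k j - Complex.mk 0 (-(20 * (k : ℝ))) → (8 / 5 ≤ ‖q - v‖ ∧ ‖q - v‖ ≤ 41 / 25 ∧ -(7 / 10) * ‖v‖ ≤ ((q - v) * (starRingEnd ℂ) v).re) ∨ (2 / 15 ≤ ‖q‖ ∧ ‖q‖ ≤ ‖v‖ + 1 / 2 ∧ 0 < (q * (starRingEnd ℂ) v).re ∧ 8 / 5 * ‖q‖ ≤ |(q * (starRingEnd ℂ) v).im| ∧ |(q * (starRingEnd ℂ) v).im| ≤ 41 / 25 * ‖q‖)) ∧ IsOpen N₀ ∧ {x : EuclideanSpace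 ℝ (Fin 4) | x ∈ Literature.Topology.FourManifolds.MMSW.modelHandlebody k ∧ Literature.Topology.FourManifolds.MMSW.levelFun k x ≤ 24 / 25 ∧ ‖Literature.AlgebraicTopology.Homotopy.HopfFibration.wC x‖ ≤ δ ∧ ∀ j, (11 : ℝ) / 4 ≤ Literature.Topology.FourManifolds.MMSW.holeTerm k j x} ⊆ N₀ ∧ (∀ l, ContDiffOn ℝ ((⊤ : ℕ∞) : WithTop ℕ∞) (SW l) N₀) ∧ (∀ l (u : ℂ), ‖u‖ = 1 → ∀ x, SW l (Literature.Topology.FourManifolds.MMSW.fibreRot (fun _ => u) x) = SW l x) ∧ ∀ l, ∀ x ∈ {x : EuclideanSpace ℝ (Fin 4) | x ∈ Literature.Topology.FourManifolds.MMSW.modelHandlebody k ∧ Literature.Topology.FourManifolds.MMSW.levelFun k x ≤ 24 / 25 ∧ ‖Literature.AlgebraicTopology.Homotopy.HopfFibration.wC x‖ ≤ δ ∧ ∀ j, (11 : ℝ) / 4 ≤ Literature.Topology.FourManifolds.MMSW.holeTerm k j x}, (Literature.AlgebraicTopology.Homotopy.HopfFibration.zC (κ x) - Literature.Topology.FourManifolds.MMSW.holeCentre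 k l) / ((‖Literature.AlgebraicTopology.Homotopy.HopfFibration.zC (κ x) - Literature.Topology.FourManifolds.MMSW.holeCentre k l‖ : ℝ) : ℂ) = Complex.exp ((SW l x : ℂ) * Complex.I) * ((Literature.AlgebraicTopology.Homotopy.HopfFibration.zC x - Literature.Topology.FourManifolds.MMSW.holeCentre k l) / ((‖Literature.AlgebraicTopology.Homotopy.HopfFibration.zC x - Literature.Topology.FourManifolds.MMSW.holeCentre k l‖ : ℝ) : ℂ)) :=
  fun k _ hδ1 => ModelHandles.exists_radial_squeeze k hδ1

/-- **Part 2 of the data stub (the equivariant squeeze of `D_k` into ball and arches)**: for every open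
`U ⊇ D_k` and `2/15 < ρ < 1/5` a diffeomorphism of `ℝ⁴`, the identity off a compact subset of `U`, commuting
with the rotations of the `w`-plane, carrying `D_k` into `B̄((-20k i, 0), ρ) ∪ ⋃ⱼ A_j`, with smooth invariant
lifts near `D_k` of the angles swept about the hole centres (`ModelHandles.data_part2`). [folklore] -/
theorem helper_handlebodyChart_modelHandles_data_part2 : ∀ (k : ℕ) (U : Set (EuclideanSpace ℝ (Fin 4))) (ρ : ℝ), IsOpen U → Literature.Topology.FourManifolds.MMSW.modelHandlebody k ⊆ U → 2 / 15 < ρ → ρ < 1 / 5 → ∃ (κ : EuclideanSpace ℝ (Fin 4) ≃ₘ⟮𝓡 4, 𝓡 4⟯ EuclideanSpace ℝ (Fin 4)) (K N₀ : Set (EuclideanSpace ℝ (Fin 4))) (SW : Fin k → EuclideanSpace ℝ (Fin 4) → ℝ), IsCompact K ∧ K ⊆ U ∧ (∀ x, x ∉ K → κ x = x) ∧ (∀ v : ℂ, ‖v‖ = 1 → ∀ x, κ (Literature.Topology.FourManifolds.MMSW.fibreRot (fun _ => v) x) = Literature.Topology.FourManifolds.MMSW.fibreRot (fun _ => v) (κ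 x)) ∧ (∀ x ∈ Literature.Topology.FourManifolds.MMSW.modelHandlebody k, κ x ∈ Metric.closedBall (Literature.AlgebraicTopology.Homotopy.HopfFibration.ofZW (Complex.mk 0 (-(20 * (k : ℝ)))) 0) ρ ∨ ∃ j, ∀ (q v : ℂ), q = Literature.AlgebraicTopology.Homotopy.HopfFibration.zC (κ x) - Complex.mk 0 (-(20 * (k : ℝ))) → v = Literature.Topology.FourManifolds.MMSW.holeCentre k j - Complex.mk 0 (-(20 * (k : ℝ))) → ‖Literature.AlgebraicTopology.Homotopy.HopfFibration.wC (κ x)‖ ≤ 1 / (2000 * ((k : ℝ) + 1)) ∧ ((8 / 5 ≤ ‖q - v‖ ∧ ‖q - v‖ ≤ 41 / 25 ∧ -(7 / 10) * ‖v‖ ≤ ((q - v) * (starRingEnd ℂ) v).re) ∨ (2 / 15 ≤ ‖q‖ ∧ ‖q‖ ≤ ‖v‖ + 1 / 2 ∧ 0 < (q * (starRingEnd ℂ) v).re ∧ 8 / 5 * ‖q‖ ≤ |(q * (starRingEnd ℂ) v).im| ∧ |(q * (starRingEnd ℂ) v).im| ≤ 41 / 25 * ‖q‖))) ∧ IsOpen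 N₀ ∧ Literature.Topology.FourManifolds.MMSW.modelHandlebody k ⊆ N₀ ∧ (∀ l, ContDiffOn ℝ ((⊤ : ℕ∞) : WithTop ℕ∞) (SW l) N₀) ∧ (∀ l (v : ℂ), ‖v‖ = 1 → ∀ x, SW l (Literature.Topology.FourManifolds.MMSW.fibreRot (fun _ => v) x) = SW l x) ∧ ∀ l, ∀ x ∈ Literature.Topology.FourManifolds.MMSW.modelHandlebody k, (Literature.AlgebraicTopology.Homotopy.HopfFibration.zC (κ x) - Literature.Topology.FourManifolds.MMSW.holeCentre k l) / ((‖Literature.AlgebraicTopology.Homotopy.HopfFibration.zC (κ x) - Literature.Topology.FourManifolds.MMSW.holeCentre k l‖ : ℝ) : ℂ) = Complex.exp ((SW l x : ℂ) * Complex.I) * ((Literature.AlgebraicTopology.Homotopy.HopfFibration.zC x - Literature.Topology.FourManifolds.MMSW.holeCentre k l) / ((‖Literature.AlgebraicTopology.Homotopy.HopfFibration.zC x - Literature.Topology.FourManifolds.MMSW.holeCentre k l‖ : ℝ) : ℂ)) :=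
  fun k U ρ hUo hDU hρ1 hρ2 => ModelHandles.data_part2 k U ρ hUo hDU hρ1 hρ2

end Summit.SmoothPoincare4.SmoothPoincare4.Theorems.DcrGap.MkFriends

end
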